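import Summits.HubbardSuperconductivity.HubbardSuperconductivity.Theorems.AnisotropyChordTransferFibre3Hole2GM3Window

/-!
# Route `AnisotropyChord` / H0 rotor rung: the GM₃ `∀L` window assembly, CELLWISE form

`gm3_allL_window` (`…Hole2GM3Window`) takes the windowed regime clause and the three β-free rows (KT-1″ `c`, KT-2a″ `a`,
KT-2b″ `b`) with constants `c, a, b` UNIFORM over the ground profiles of `(L, Δ)`.  The Level-2 kernel campaigns
(p2's row `N₁` cells `trialGap_cellN…`, p1's row-C cells `offPoleTail_cellN…`, the row-D cells to come) certify the rows
CELL BY CELL in `(ν, a) = (λ₂/θ², Δ·f(x̂))` with cell-dependent constants.  Since the ground two-magnon profile of `(L, Δ)` is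
UNIQUE (`ground_unique`, `…GroundUnique`), cellwise constants suffice:
★ `gm3_cellwise`: for `L ≥ 31`, `0 < Δ < 1`, if for every ground profile in the window `0 < λ₂ ≤ .0513θ²` there EXIST
`c, a, b` with `0 ≤ mHole`, `facMI·η_eff·(a + b/(2 + cos θ)) < c`, `c·U ≤ N₁`, `lowG ≤ a·η_eff·U`,
`‖R′‖² − P − lowN ≤ b·η_eff·(2ε₁ − T⁺)·U`, then `GM3Fibre L Δ`.
The per-cell form ★ `gm3_of_cell` packages the same with the cell-location hypotheses `ν ∈ [ν₁, ν₂]`, `a ∈ [a₁, a₂]` as they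
appear in the campaign theorems (the caller supplies the cell containing the profile).
Prover seat `hubbard-h0-rotor-p1` g28 (route lead); helper for piece A = stmt-HubbardSuperconductivity-23918 of rung 19089
(`--supports`, helper class).  Nothing here proves superconductivity in the Hubbard model; the assembly form of ONE conditional
reduction (the GM₃ ∀L certificate); the rotor TARGET as originally worded stays FALSE (g15 verdict). Tree imports only; no sorry.
-/

set_option linter.dupNamespace false
set_option autoImplicit false

noncomputable section

namespace Summit.HubbardSuperconductivity.HubbardSuperconductivity.Theorems.AnisotropyChord.Transfer.Fibre3

variable (L : ℕ) [NeZero L]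

/-- ★ **GM₃ from CELLWISE constants** (`L ≥ 31`, `0 < Δ < 1`): by uniqueness of the ground profile, constants `c, a, b`
depending on the profile are as good as uniform ones in `gm3_allL_window`. [folklore] -/
theorem gm3_cellwise (hL : 31 ≤ L) {Δ : ℝ} (hΔ0 : 0 < Δ) (hΔ1 : Δ < 1)
    (hcell : ∀ lam2 : ℝ, ∀ f : Tor L → ℝ, IsGroundTwoMagnon L Δ lam2 f →
      0 < lam2 → lam2 ≤ 0.0513 * (2 * Real.pi / L) ^ 2 →
        ∃ c a b : ℝ,
          (0 ≤ mHole L Δ f ∧ facMI L Δ f * etaEff L lam2 * (a + b / (2 + Real.cos (2 * Real.pi / L))) < c) ∧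
          c * Uunit L Δ f ≤ trialGapN1 L Δ f ∧
          lowGForm L Δ f ≤ a * etaEff L lam2 * Uunit L Δ f ∧
          (ip L (resid L Δ f) (resid L Δ f)).re - polePart L Δ f - lowNormPart L Δ f
            ≤ b * etaEff L lam2 * (2 * eps1 L - Tplus L Δ f) * Uunit L Δ f) :
    GM3Fibre L Δ := by
  have hL2 : 2 ≤ L := by omega
  obtain ⟨lam2, f, hf⟩ := exists_ground L hL2 Δ
  have hl0 : 0 < lam2 := lam2_pos L (by omega) hΔ1 hf.1
  have hlw : lam2 ≤ 0.0513 * (2 * Real.pi / L) ^ 2 := nu_le_of_ge_31 L hL hΔ0.le hf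
  obtain ⟨c, a, b, hreg, h1, h2, h3⟩ := hcell lam2 f hf hl0 hlw
  -- every ground profile of `(L, Δ)` IS `(lam2, f)`
  have huniq : ∀ lam2' : ℝ, ∀ g : Tor L → ℝ, IsGroundTwoMagnon L Δ lam2' g → lam2' = lam2 ∧ g = f := by
    intro lam2' g hg
    obtain ⟨h1', h2'⟩ := ground_unique L hL2 hg hf
    exact ⟨h1', h2'⟩
  refine gm3_allL_window L hL hΔ0 hΔ1 c a b ?_ ?_ ?_ ?_
  · intro lam2' g hg _ _
    obtain ⟨rfl, rfl⟩ := huniq lam2' g hg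
    exact hreg
  · intro lam2' g hg _ _
    obtain ⟨rfl, rfl⟩ := huniq lam2' g hg
    exact h1
  · intro lam2' g hg _ _
    obtain ⟨rfl, rfl⟩ := huniq lam2' g hg
    exact h2
  · intro lam2' g hg _ _
    obtain ⟨rfl, rfl⟩ := huniq lam2' g hg
    exact h3

/-- ★ **GM₃ from ONE certified cell**: if the ground profiles of `(L, Δ)` (`L ≥ 31`, `0 < Δ < 1`) are known to lie in the cell
`ν = λ₂/θ² ∈ [ν₁, ν₂]`, `Δ·f(x̂) ∈ [a₁, a₂]`, and on that cell the windowed regime clause and the three rows hold with constants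
`c, a, b`, then `GM3Fibre L Δ`.  (The campaign theorems `trialGap_cellN…`, `offPoleTail_cellN…`, … are exactly the row
hypotheses; a cover argument supplies the location.) [folklore] -/
theorem gm3_of_cell (hL : 31 ≤ L) {Δ : ℝ} (hΔ0 : 0 < Δ) (hΔ1 : Δ < 1) (ν1 ν2 a1 a2 c a b : ℝ)
    (hloc : ∀ lam2 : ℝ, ∀ f : Tor L → ℝ, IsGroundTwoMagnon L Δ lam2 f →
      ν1 ≤ lam2 / (2 * Real.pi / L) ^ 2 ∧ lam2 / (2 * Real.pi / L) ^ 2 ≤ ν2 ∧ a1 ≤ Δ * f (K1 L) ∧ Δ * f (K1 L) ≤ a2)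
    (hreg : ∀ lam2 : ℝ, ∀ f : Tor L → ℝ, IsGroundTwoMagnon L Δ lam2 f →
      ν1 ≤ lam2 / (2 * Real.pi / L) ^ 2 → lam2 / (2 * Real.pi / L) ^ 2 ≤ ν2 → a1 ≤ Δ * f (K1 L) → Δ * f (K1 L) ≤ a2 →
        0 ≤ mHole L Δ f ∧ facMI L Δ f * etaEff L lam2 * (a + b / (2 + Real.cos (2 * Real.pi / L))) < c)
    (hKT1 : ∀ lam2 : ℝ, ∀ f : Tor L → ℝ, IsGroundTwoMagnon L Δ lam2 f →
      ν1 ≤ lam2 / (2 * Real.pi / L) ^ 2 → lam2 / (2 * Real.pi / L) ^ 2 ≤ ν2 → a1 ≤ Δ * f (K1 L) → Δ * f (K1 L) ≤ a2 →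
        c * Uunit L Δ f ≤ trialGapN1 L Δ f)
    (hKT2a : ∀ lam2 : ℝ, ∀ f : Tor L → ℝ, IsGroundTwoMagnon L Δ lam2 f →
      ν1 ≤ lam2 / (2 * Real.pi / L) ^ 2 → lam2 / (2 * Real.pi / L) ^ 2 ≤ ν2 → a1 ≤ Δ * f (K1 L) → Δ * f (K1 L) ≤ a2 →
        lowGForm L Δ f ≤ a * etaEff L lam2 * Uunit L Δ f)
    (hKT2b : ∀ lam2 : ℝ, ∀ f : Tor L → ℝ, IsGroundTwoMagnon L Δ lam2 f →
      ν1 ≤ lam2 / (2 * Real.pi / L) ^ 2 → lam2 / (2 * Real.pi / L) ^ 2 ≤ ν2 → a1 ≤ Δ * f (K1 L) → Δ * f (K1 L) ≤ a2 →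
        (ip L (resid L Δ f) (resid L Δ f)).re - polePart L Δ f - lowNormPart L Δ f
          ≤ b * etaEff L lam2 * (2 * eps1 L - Tplus L Δ f) * Uunit L Δ f) :
    GM3Fibre L Δ := by
  refine gm3_cellwise L hL hΔ0 hΔ1 fun lam2 f hf _ _ => ?_
  obtain ⟨n1, n2, b1, b2⟩ := hloc lam2 f hf
  exact ⟨c, a, b, hreg lam2 f hf n1 n2 b1 b2, hKT1 lam2 f hf n1 n2 b1 b2, hKT2a lam2 f hf n1 n2 b1 b2,
    hKT2b lam2 f hf n1 n2 b1 b2⟩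

end Summit.HubbardSuperconductivity.HubbardSuperconductivity.Theorems.AnisotropyChord.Transfer.Fibre3

end
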